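import Summits.BirchSwinnertonDyer.Rank1Residual.F1Sign2.AdditiveNewPartLawsAtTwo
import HarnessLib

/-!
# Cell `bsd-f1-sign2`, lens `-imc` g8 (MEMO-imc §10.68–§10.70): the SIGN law at additive `2` SPLITS —
# IMC-LTS `LocalTowerSignLawAtTwo` (θ-free, Selmer-free, `@[conjecture]`, row of record of g8),
# IMC-FEP `NewPartPhaseLawAtTwo` (the analytic phase of the new part; print-assembly grade, plain def),
# IMC-SIGN≥2 `AdditiveNewPartSignLawAtTwoFrom2` (the SIGN law of record restricted to `n ≥ 2`, scope hypotheses removed, plain def),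
# IMC-LTS-pm `LocalTowerSignLawAtTwoPotMult` (support: LTS restricted to potentially multiplicative reduction, the nominated first rung T2)
# and the glue target `SignLawSplitsAtTwo` (LTS + FEP ⇒ SIGN≥2, stated as a `Prop`)

Frame and helper defs are those of `AdditiveNewPartLawsAtTwo.lean` (p628841): `LayerAdditiveAboveTwo`, `layerTwoMinDiscOrd`,
`layerTamagawaTwoVal`, `newPartNormTwoVal`, `additiveNewPartIndex`; new helpers here: `conductorExponentAtTwo` (`f₂ = v₂ N_W`),
`oddConductorPart` (`N′`), `twoAdicTwistSign` (`ρ₂ = w(W)·w(W^{(2)})·χ₈(N′)`), `towerCorrectionJumpAtTwo` (`J_n = δu_n + δTam_n`),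
`newPartPhaseIndicator` (`X_n = [f₂ = 2n+2]`), and the PROVED bookkeeping identity `additiveNewPartIndex_eq_sub_towerCorrectionJump`
(`R_n = ℓ′_n − J_n`).  Nothing is asserted: `def … : Prop` only, one `@[conjecture]`.

TYPER FILING (cell `bsd-f1-sign2`, seat `-ty` g9; CANDIDATES.md rows IMC-LTS / IMC-FEP / IMC-SIGN≥2 / glue; -imc g8 CANDIDATES-delta v3.0
2026-08-28T12:17:29Z, filing ask «file the rows as `F1Sign2/LocalTowerSignLawAtTwo.lean`»; cell rule «file statement-only AFTER REF1»): the body of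
`HOME/MEMO-imc-data/dimc30/lean/SketchG8LTS.lean` fcd46f9b43d96a46 (-imc: farm rc 0 · 0/0/0; BC7 4/4 CLEAN `ProbeG8LTS.out` 14e7374129d0be72)
VERBATIM from `noncomputable section` on (same namespace `…Rank1Residual.F1Sign2`, imports ONLY the accepted `F1Sign2.AdditiveNewPartLawsAtTwo`);
typer edits (D-imc-33 filing riders, -imc g8 CANDIDATES-delta v3.1 13:06:42Z) = this header; in the LTS docstring the D-imc-30 (+ ADDENDUM-1,
n = 6, 7) outcome numbers, the Kramer–Tunnell reading in its CORRECTED form (KTD_n; (T_n) recorded as the prover's target, REF2 v28 r1; c1 filed —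
the draft's «naive char-2 transplant fails» clause is gone), the REF2 v28 c4 cite fixes (KT82 Thm 7.6 not 7.2; DD 2011 Thm 5 = Thm 24; Česnavičius–Imai
2016), the two-engine coverage line (REF1 §106-add, 56 688/56 688), REF1 §106 riders r1/r3/r6 and REF2 v28 r4/r5, and the REF1/REF2 texts; in the
LTS-pm docstring REF1 r3's classification + KT82 §§5–6.  Statements: 12/12 decls VERBATIM (REF1 cmpdecls).  Bib key `CesnaviciusImai2015` added.
Builder `tools/mk_lts.py` (`HOME/MEMO-ty-data/g9/`).
REF1-AUDIT §106 (refuter-bsd-f1-sign2-ref1 g10, 2026-08-28T12:41:17Z; evidence `HOME/REF1-data/b106/`, Probe106.lean 7989122e9b22b7c3 farm rc 0; recount106.py; D-ty-ref1-25 GATE OPEN): IMC-LTS `LocalTowerSignLawAtTwo` SURVIVES as typed, conjecture-grade, CLEARED statement-only from draft dbb276e3dc0e4e9e (= SketchG8LTS fcd46f9b43d96a46, 12/12 decls identical); support rows FEP / SIGN≥2 / glue / LTS-pm SURVIVE; KILLED none; elaboration rc 0, kernel lemmas e1–e5 (N′ odd, ρ₂ ∈ {±1}, κ inhabited, phase/range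 automatic for n ≥ 4 / n ≥ 3 given f₂ ≤ 8, glue `SignLawSplitsAtTwo` PROVED modulo the ℓ′-rescaling parity `Even (newPartNormTwoVal n (C c * θ) − newPartNormTwoVal n θ)`, c ≠ 0, n ≥ 2), axioms ⊆ {propext, Classical.choice, Quot.sound}; A2: `/12` exact on every model, J_n parity model-independent for n ≥ 2, ρ₂ = w(W)w(W^{(2)})χ₈(N′) = w₂(W)w₂(W^{(2)}) = w(W/ℚ₂(√2)) ∈ {±1} exactly; independent recount of D-imc-30 from the raw PARI columns: X5 17 486/17 486 cells (n = 2..5; n = 4, 5: 4 393 + 4 393), PRED-30 8 778/8 778, random 2-adic models 17 338/17 338, CM 90/90, parity(J_4) = parity(J_5) 4 393/4 393, Ogg consistency 56 688/56 688 (curve, layer) pairs; pot.-mult. closed form confirmed on 431 curves × 5 layers in both Tate classes (γ = −c₄/c₆ ∈ {−1, −2, 3, 6}); A6 mutation: dropping X_n, or ρ₂ ↦ w₂ or w, or `2 ≤ n` is FALSE in the table (1 734/3 526 n = 1 cells violate); dropping BOTH `LayerAdditiveAboveTwo` hypotheses gives 0 violations on all 2 332 out-of-scope cells (info for -imc: an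 LTS⁺ without them survives the table; no retyping asked); riders r1–r8 text-only (r2: 2-local companion of ρ₂ via `rootNumberTwo'` recommended for the T2 rung; r4 keep `4 ∣ N`; r5 glue debt = the rescaling lemma only; r8 the four untagged support Props class like the accepted `AdditiveMazurTateDeflationAtTwo`).  PARTITION: none moved; beyond-print theorem: no.
REF2-PLACEMENT v28 §1 (refuter-bsd-f1-sign2-ref2 g28, `HOME/REF2-PLACEMENT-v28.md` fc0aaef95ab177ac; REF2_TXT_LTS §1.11 verbatim, cite keys normalised to the bib): «PLACEMENT (REF2 v28 §1, 2026-08-28): NOT IN PRINT as stated; conjecture-grade; grade NEW-COMBINATION. By Kramer–Tunnell 1982 Thm 7.6 (norm index = c_F c′_F c_K⁻¹ q^{v(u_F)+v(u′_F)−v(u_K)}, valid for every separable quadratic extension of local fields, residue characteristic 2 and additive reduction included — KT's Example p.334 and Lemma 8.23) composed with Dokchitser–Dokchitser 2011 Thm 5 (the Kramer–Tunnell conjecture) and the root-number algebra w(W/L_k) = ρ₂ (k ≥ 1), the law is EQUIVALENT, cell by cell, to (T_n): ord₂ C(W⊗η_n/L_{n−1}, ω_{A′}) ≡ [f₂ =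 2n+2] + [Δ′_W ≡ ±3 (mod 8)] (mod 2), a parity statement about Tate's algorithm for the single quadratic twist of W by d_n = 2 + ζ_{2^{n+1}} + ζ̄ over ℚ₂(ζ_{2^{n+1}})⁺ (REF2-data/v28-ktd: the identity (−1)^{J_n+t_n} = ρ₂(Δ_W,2)₂ holds on 17 968/17 968 (curve, step) pairs, n ≤ 4, by an exact Tate engine validated 22 460/22 460 against PARI). In print by stratum: potentially multiplicative — KT82 §§5–6; f₂ = 2 (types IV/IV*) — KT82 Prop 8.20/Lemma 8.23/Prop 8.24; potentially good with f₂ ∈ {3,…,8} — not in print (the cases Dokchitser–Dokchitser 2011 Thm 24 lists as open in KT and settle globally; Comalada 1994 / Barrios et al. 2025 (arXiv:2501.03209) give twist Tate data at residue characteristic 2 only over ℚ₂). Beyond-print theorem if proved: yes (small/medium: KT82-§8-type analysis of the remaining 2-adic types along η_n); BSD untouched.» (REF2's further pointers «Dokchitser–Dokchitser 2015 Compositio Thm 5 / Rem 7» and Česnavičius–Imai (the remaining cases of the Kramer–Tunnell conjecture, Compositio 152 (2016)) are recorded here in prose; grades: IMC-LTS NEW-COMBINATION, IMC-FEP = (A)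 KNOWN-ASSEMBLY ⊕ (A′) one boundary local-ε lemma unlocated-but-routine (v28 r6); beyond-print theorem: no.)
bears_on: the cell's SEARCH QUESTION on the additive third («the ± object at 2» = `ρ₂ = w(W/ℚ₂(√2))`, the ± bookkeeping object = the pair
(`δu_n`, `δTam_n`) of Tate-algorithm jumps with a one-time phase at `n = (f₂ − 2)/2`); rows IMC-ADD2-SIGN (p628841) / IMC-NP2-SIGN (p631009);
asks D-imc-ref1-30, D-imc-ref2-30, D-imc-31 (second engine for tower Tate data), D-imc-32 (definition request `localNormIndexAtTwo`).
-/

noncomputable section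

open scoped Classical MatrixGroups ModularForm NumberField

open CongruenceSubgroup Polynomial WeierstrassCurve Literature.NumberTheory.EllipticCurves
  Literature.NumberTheory.EllipticCurves.ModularForms
  Literature.NumberTheory.EllipticCurves.Rank1Residual ZpExtension IsDedekindDomain

namespace Summit.BirchSwinnertonDyer.Rank1Residual.F1Sign2

/-- `f₂(W) := v₂(N_W)`, the conductor exponent of `W/ℚ` at `2` read off the conductor `N_W = W.conductorNorm ℤ`
(`factorization_conductorNorm`). Junk `0` for singular `W` (`N = 1`). -/
def conductorExponentAtTwo (W : WeierstrassCurve ℚ) : ℕ :=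
  (W.conductorNorm ℤ).factorization 2

/-- `N′ := N_W / 2^{f₂}`, the odd part of the conductor. -/
def oddConductorPart (W : WeierstrassCurve ℚ) : ℕ :=
  W.conductorNorm ℤ / 2 ^ conductorExponentAtTwo W

/-- `ρ₂(W) := w(W)·w(W^{(2)})·χ₈(N′) ∈ {±1}`: for `W` additive at `2` this is the product of the LOCAL root numbers at `2` of `W` and of
its twist by `ℚ(√2)` (`= w(W/ℚ₂(√2))`; the odd places contribute `χ₈(p^{f_p})` to `w(W)·w(W^{(2)})`, REF2 v26 §1.4), written with the
tree's analytic global `rootNumber` because `localRootNumber` is junk `0` at additive `2`. -/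
def twoAdicTwistSign (W : WeierstrassCurve ℚ) : ℤ :=
  W.rootNumber * (W.quadraticTwist 2).rootNumber * ZMod.χ₈ (oddConductorPart W : ZMod 8)

/-- **The tower correction jump `J_n`** at the prime above `2` between layers `n − 1` and `n` of `κ`:
`J_n := δu_n + δTam_n = (2^{n−1}·v₂(Δ_W) + D_{n−1} − D_n)/12 + (v₂ Tam(W/ℚ_n) − v₂ Tam(W/ℚ_{n−1}))` — exactly the two correction terms of
`additiveNewPartIndex` (`R_n = ℓ′_n(θ_n) − J_n`, `additiveNewPartIndex_eq_sub_towerCorrectionJump`).  Purely local Tate-algorithm data of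
`W` over `ℚ_{n−1}` and `ℚ_n`; for `n ≥ 2` its parity is model-independent (`W ↦ u·W` shifts `δu_n` by `2^{n−1}v₂(u)`) and the odd primes
contribute evenly to `δTam_n` (elementary: in the cyclic `2`-tower an odd prime inert in `ℚ_{n−1}` stays inert, so the number of primes
above it is even as soon as its residue degree is `< 2^n`; census 4 389/4 389 at `n = 2, 3`). -/
def towerCorrectionJumpAtTwo (W : WeierstrassCurve ℚ) (κ : ZpExtension ℚ 2) (n : ℕ) : ℤ :=
  ((2 : ℤ) ^ (n - 1) * padicValRat 2 W.Δ + (layerTwoMinDiscOrd W κ (n - 1) : ℤ) - (layerTwoMinDiscOrd W κ n : ℤ)) / 12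
    + ((layerTamagawaTwoVal W κ n : ℤ) - (layerTamagawaTwoVal W κ (n - 1) : ℤ))

/-- `R_n = ℓ′_n − J_n` (definitional bookkeeping). -/
theorem additiveNewPartIndex_eq_sub_towerCorrectionJump {N : ℕ} (f : CuspForm (Gamma0 N) 2)
    (W : WeierstrassCurve ℚ) (ϖ : ℚ) (κ : ZpExtension ℚ 2) (n : ℕ) :
    additiveNewPartIndex f W ϖ κ n
      = newPartNormTwoVal n (C ϖ * mazurTateElement f 2 n) - towerCorrectionJumpAtTwo W κ n := by
  unfold additiveNewPartIndex towerCorrectionJumpAtTwo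
  ring

/-- The phase indicator `X_n := [f₂ = 2n + 2]` of the new characters of layer `n` (conductor `2^{n+2}`): inside the range `f₂ ≤ 2n + 2`
the Gauss-sum phase of `τ(χ)²·χ(N′)·(local factor at 2)` is trivial unless `f₂` sits exactly at the edge `2n + 2` (data: `X_2 = 1` on 438/438
curves with `f₂ = 6`, `X_3 = 1` on 24/24 with `f₂ = 8`, `X_n = 0` on 3 870 + 4 367 + 4 431 + 4 461 cells with `f₂ ≤ 2n + 1`, `n = 2..5`). -/
def newPartPhaseIndicator (W : WeierstrassCurve ℚ) (n : ℕ) : ℤ :=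
  if conductorExponentAtTwo W = 2 * n + 2 then 1 else 0

/-- **IMC-LTS `LocalTowerSignLawAtTwo`** — candidate of record of `-imc` g8, conjecture-grade, **θ-FREE and SELMER-FREE**
(REF2 v26 §1 leg (B): «the 2-local tower sign law … not in print», there stated with an ε-factor phase; here the phase is the explicit
indicator `X_n = [f₂ = 2n+2]`).  For `W/ℚ` elliptic with ADDITIVE reduction at `2` (`4 ∣ N_W`), the cyclotomic `ℤ₂`-extension `κ`
(`ℚ_n = ℚ(ζ_{2^{n+2}})⁺`), a layer `n ≥ 2` with `f₂ ≤ 2n + 2` such that `W` is additive above `2` over `ℚ_{n−1}` and `ℚ_n`: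
`J_n + X_n ≡ 0 (mod 2) ⟺ ρ₂(W) = +1`, i.e. **the parity of the jump of the local BSD correction (minimal-model scaling + Tamagawa
valuation) from layer `n−1` to layer `n` is the product of the local root numbers at `2` of `W` and `W^{(2)}`**, up to the edge phase `X_n`.
Every term is computed by Tate's algorithm over `ℚ₂(ζ_{2^{n+1}})⁺` and `ℚ₂(ζ_{2^{n+2}})⁺` — no `L`-value, no Mazur–Tate element, no Selmer group.
WHY (BSD bookkeeping, MEMO-imc §10.68): SIGN (`AdditiveNewPartSignLawAtTwo`, 10 142/10 142) ⊕ the functional-equation phase of the new part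
(`NewPartPhaseLawAtTwo`) — the θ-dependence cancels (`additiveNewPartSignLaw_of_split`).  Equivalently (Kramer–Tunnell form): the parity of
`J_n + X_n` is the parity of the local norm index `dim_{𝔽₂} W(ℚ_{n−1,𝔭})/N W(ℚ_{n,𝔭})` of the quadratic layer step at the prime above 2.
CENSUS = BC5 WITNESS (zero new compute; Tate data of D-imc-22/23, `theta.py` 0d3b9b7d39e9135c, 4 466 non-CM curves `4 ∣ N ≤ 6 000`;
`HOME/MEMO-imc-data/dimc30/lts_test.out` c6e8a33917d3e42a): `n = 2`: **3 870/3 870** cells with `f₂ ≤ 5` and **438/438** with `f₂ = 6`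
(`X_2 = 1`); `n = 3`: **4 367/4 367** with `f₂ ≤ 7` and **24/24** with `f₂ = 8`; among them **679 cells with `θ_n = 0`**, invisible to every
θ-based row.  `ρ₂` is NOT a function of the `2`-adic type `(f₂, Kodaira/ℚ₂, v₂Δ_min)`: 36 of the 76 types carry both signs, so the law reads
the finer datum `w₂(W)w₂(W^{(2)})` off the TOWER behaviour of Tate's algorithm.  NEW-LAYER FALSIFIER D-imc-30 (pre-registered README-30.md
3b802a0067644763, PRED-30.json b069f05a024b237f: layers `n = 4, 5` = Tate's algorithm over the degree-16/32 fields, 8 782 per-cell predictions,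
plus random `2`-adic models with `ρ₂` read locally; kit j308118/j308119, tag `bsd-frontier-data`, `harvest30-n5.out` 7899814e380d51ac; MEMO-imc
§10.69/§10.70, INBOX 2026-08-28T12:17:29Z): K30-1 LTS at the NEW layers `n = 4`: 4 393/4 393 and `n = 5`: 4 393/4 393 X5 additive curves (8 786
cells, 0 violations); K30-3 LTS on 4 956 RANDOM `2`-adic models, `n = 2..5`: 17 338/17 338; K30-2 regression NP2-SIGN `n = 4/5`: 4 359 + 4 388,
0 violations; K30-4 `ρ₂` global = local 4 391/4 391; CM 90/90; C30-0 13 169/13 169 (≈ 34 900 cells; `n = 6, 7` running at filing, j308218/j308222).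
NOT COVERED: `n = 1` (the `E^{(2)}`-BSD₂-mod-squares statement, D-imc-25, open) and `n = 2` with `f₂ ∈ {7, 8}` (39 curves; phase type-dependent,
REF2 v26 r3).  WHY NOVEL: a θ-free, Selmer-free identity between Tate-algorithm jumps up the `2`-cyclotomic tower and local root numbers at
additive `2`; nearest print = Kramer–Tunnell 1982 / Dokchitser–Dokchitser 2011 Thm 5 (arXiv:0906.1815 numbering; = Thm 24 of §4) («local norm index ↔
local root numbers» for ONE quadratic extension — the Kramer–Tunnell CONJECTURE, proved at residue characteristic 2 via global arguments, DD 2011 §1,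
and in the remaining cases by Česnavičius–Imai 2016 (Compositio 152); this is not to be read as «no norm-index FORMULA at 2»: KT82 Thm 7.6 is
unrestricted, REF2 v28 c2/c4); the TOWER form with the explicit Tate-jump `J_n` and the edge phase `X_n` is not in print (REF2 v26 §1.6, v28 §1.8:
LTS = the ELIMINATION of KT's third Tate datum, unprinted for potentially good `f₂ ≥ 3`).
PROVABILITY (MEMO §10.70): both sides are locally constant on the compact space of additive `2`-adic Weierstrass models and the potentially
multiplicative family is closed-form, so each fixed `n` is a FINITE `2`-adic computation (potentially good: `v₂(Δ_min) ≤ 18` by Kraus 1989 /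
Papadopoulos 1993, model determined to the needed precision by `(a₁,…,a₆) mod 2^k`) — the cell's first beyond-print-small theorem path on the
additive third.
KRAMER–TUNNELL READING = THE PROVER'S TARGET (MEMO-imc §10.70/§10.73, REF2 v28 §1.3–§1.6 r1, REF1 §106 A2; statement-only prose): with `i_n` the
local norm index of the step `L_n = ℚ₂(ζ_{2^{n+2}})⁺ ⊃ L_{n−1}` and `t_n := ord₂ C(W⊗η_n/L_{n−1}, ω_{A′})` the third Tate datum of KT82 Thm 7.6 (the twist
of `W` by `d_n = 2 + ζ_{2^{n+1}} + ζ̄` over `L_{n−1}`): (KTD_n) `(−1)^{J_n + t_n} = ρ₂·(−Δ_W, 2)₂` for ALL `W`, `n` (KT82 Thm 7.6 ∘ DD 2011 Thm 5 ∘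
`w(W/L_k) = ρ₂`; REF2-data/v28-ktd 17 968/17 968, `n ≤ 4`; -imc r2 re-run 13 382/13 382 in-range cells), hence LTS_n ⟺ NI_n ⟺
**(T_n): `t_n ≡ [f₂ = 2n+2] + [Δ′_W ≡ ±3 (mod 8)] (mod 2)`** — the phase and the `Δ`-mod-8 term EVALUATE KT's twisted-curve term (they do not
replace it; REF2 v28 c1, -imc §10.73 c1 filed).  (T_n) is the statement a prover attacks (typing it as a row needs Tate data of a curve over
`ℚ_{n−1}`, which the tree's layer functions do not take — REF2 v28 r1); print status by stratum: potentially multiplicative — KT82 §§5–6 (rung T2 =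
`LocalTowerSignLawAtTwoPotMult` below); `f₂ = 2` (IV/IV*) — KT82 Prop 8.20 / Lemma 8.23 / Prop 8.24; potentially good `f₂ ∈ {3,…,8}` (60 % of the
range) — NOT in print = T5, FIRST TARGET D-imc-34 = (T_2)^{f₂=3} («`W/ℚ₂` potentially good, `f₂ = 3` (III / I₁* / III* / II*: 290/334/153/252 X5
curves) ⇒ `ord₂ C(W⊗η₂/ℚ₂(√2), ω_{A′}) ≡ [Δ′_W ≡ ±3 (8)]`», census 1 029/1 029 + 443/443 random, six-line Kraus-class table MEMO-imc §10.74,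
`dimc30/t2f3_table.out` b15caac1167880f6); T6 tower induction «`t_{n+1} ≡ t_n`, `n ≥ 4`» (§10.72: parity(`J_n`) frozen for `n = 4..7` on
4 393/4 393); T3 (formal-group norm cokernels) RETIRED for LTS (REF2 v28 r5); T1 (Prop (a) over a `localNormIndexAtTwo` decl, D-imc-32) and REF1
§106 r2's 2-LOCAL companion `twoAdicTwistSignLocal W := W.rootNumberTwo' * (W.quadraticTwist 2).rootNumberTwo'` + bridge Prop (K30-4 4 391/4 391)
are OPTIONAL follow-up defs, not in this filing.  REF1 §106 r6: `f₂ ≤ 2n + 2` is automatic for `n ≥ 3` and `X_n = 0` for `n ≥ 4` given `f₂ ≤ 8`,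
so the layers `n = 4..7` test the pure law; r1: the typed `δTam` is the TOTAL Tamagawa valuation, parity-equivalent to the census's prime-above-2
jump for `n ≥ 2` by the odd-prime two-case lemma (fails only at `n = 1`: 575 curves).  ADDENDUM-1 (§10.72, pre-registered K30-1′/K30-3′, kit
j308218 + j308222): LTS at `n = 6, 7` — X5 additive 4 393/4 393 + 4 393/4 393, random models 4 442/4 442 + 4 442/4 442, CM 24 + 24; cumulative θ-free
LTS census 52 631 cells, 0 violations (`harvest30-n7.out` 9a0abbd401b51389).  TWO ENGINES (REF1 §106-add, kit j308959; REF2 v28 `tate.py`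
38f95975a27fdb4b): PARI `elllocalred`/`nfinit` (D-imc-22/23, D-imc-30) and exact Tate over `ℤ[ζ_{2^{k+2}}]⁺` (REF2 run `k ≤ 4`; REF1 kit j308959
`k = 5` + random models; `k = 4` by both) agree on 56 688/56 688 (model, layer) cells.
REF1-AUDIT §106 (refuter-bsd-f1-sign2-ref1 g10, 2026-08-28T12:41:17Z; evidence `HOME/REF1-data/b106/`, Probe106.lean 7989122e9b22b7c3 farm rc 0; recount106.py; D-ty-ref1-25 GATE OPEN): IMC-LTS `LocalTowerSignLawAtTwo` SURVIVES as typed, conjecture-grade, CLEARED statement-only from draft dbb276e3dc0e4e9e (= SketchG8LTS fcd46f9b43d96a46, 12/12 decls identical); support rows FEP / SIGN≥2 / glue / LTS-pm SURVIVE; KILLED none; elaboration rc 0, kernel lemmas e1–e5 (N′ odd, ρ₂ ∈ {±1}, κ inhabited, phase/range automatic for n ≥ 4 / n ≥ 3 given f₂ ≤ 8, glue `SignLawSplitsAtTwo` PROVED modulo the ℓ′-rescaling parity `Even (newPartNormTwoVal n (C c * θ) − newPartNormTwoVal n θ)`, c ≠ 0, n ≥ 2), axioms ⊆ {propext, Classical.choice,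 Quot.sound}; A2: `/12` exact on every model, J_n parity model-independent for n ≥ 2, ρ₂ = w(W)w(W^{(2)})χ₈(N′) = w₂(W)w₂(W^{(2)}) = w(W/ℚ₂(√2)) ∈ {±1} exactly; independent recount of D-imc-30 from the raw PARI columns: X5 17 486/17 486 cells (n = 2..5; n = 4, 5: 4 393 + 4 393), PRED-30 8 778/8 778, random 2-adic models 17 338/17 338, CM 90/90, parity(J_4) = parity(J_5) 4 393/4 393, Ogg consistency 56 688/56 688 (curve, layer) pairs; pot.-mult. closed form confirmed on 431 curves × 5 layers in both Tate classes (γ = −c₄/c₆ ∈ {−1, −2, 3, 6}); A6 mutation: dropping X_n, or ρ₂ ↦ w₂ or w, or `2 ≤ n` is FALSE in the table (1 734/3 526 n = 1 cells violate); dropping BOTH `LayerAdditiveAboveTwo` hypotheses gives 0 violations on all 2 332 out-of-scope cells (info for -imc: an LTS⁺ without them survives the table; no retyping asked); riders r1–r8 text-only (r2: 2-local companion of ρ₂ via `rootNumberTwo'` recommended for the T2 rung; r4 keep `4 ∣ N`; r5 glue debt = the rescaling lemma only; r8 the four untagged support Props class like the accepted `AdditiveMazurTateDeflationAtTwo`).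  PARTITION: none moved; beyond-print theorem: no.
REF2-PLACEMENT v28 §1 (refuter-bsd-f1-sign2-ref2 g28, `HOME/REF2-PLACEMENT-v28.md` fc0aaef95ab177ac; REF2_TXT_LTS §1.11 verbatim, cite keys normalised to the bib): «PLACEMENT (REF2 v28 §1, 2026-08-28): NOT IN PRINT as stated; conjecture-grade; grade NEW-COMBINATION. By Kramer–Tunnell 1982 Thm 7.6 (norm index = c_F c′_F c_K⁻¹ q^{v(u_F)+v(u′_F)−v(u_K)}, valid for every separable quadratic extension of local fields, residue characteristic 2 and additive reduction included — KT's Example p.334 and Lemma 8.23) composed with Dokchitser–Dokchitser 2011 Thm 5 (the Kramer–Tunnell conjecture) and the root-number algebra w(W/L_k) = ρ₂ (k ≥ 1), the law is EQUIVALENT, cell by cell, to (T_n): ord₂ C(W⊗η_n/L_{n−1}, ω_{A′}) ≡ [f₂ = 2n+2] + [Δ′_W ≡ ±3 (mod 8)] (mod 2), a parity statement about Tate's algorithm for the single quadratic twist of W by d_n = 2 + ζ_{2^{n+1}} + ζ̄ over ℚ₂(ζ_{2^{n+1}})⁺ (REF2-data/v28-ktd: the identity (−1)^{J_n+t_n}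 = ρ₂(Δ_W,2)₂ holds on 17 968/17 968 (curve, step) pairs, n ≤ 4, by an exact Tate engine validated 22 460/22 460 against PARI). In print by stratum: potentially multiplicative — KT82 §§5–6; f₂ = 2 (types IV/IV*) — KT82 Prop 8.20/Lemma 8.23/Prop 8.24; potentially good with f₂ ∈ {3,…,8} — not in print (the cases Dokchitser–Dokchitser 2011 Thm 24 lists as open in KT and settle globally; Comalada 1994 / Barrios et al. 2025 (arXiv:2501.03209) give twist Tate data at residue characteristic 2 only over ℚ₂). Beyond-print theorem if proved: yes (small/medium: KT82-§8-type analysis of the remaining 2-adic types along η_n); BSD untouched.» (REF2's further pointers «Dokchitser–Dokchitser 2015 Compositio Thm 5 / Rem 7» and Česnavičius–Imai (the remaining cases of the Kramer–Tunnell conjecture, Compositio 152 (2016)) are recorded here in prose; grades: IMC-LTS NEW-COMBINATION, IMC-FEP = (A) KNOWN-ASSEMBLY ⊕ (A′) one boundary local-ε lemma unlocated-but-routine (v28 r6); beyond-print theorem: no.)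
PARTITION: none moved (frontier-tier search object, off the crux-23715 path); beyond-print theorem: no (if (T_n) is proved on the potentially good
`f₂ ≥ 3` strata: yes, small/medium per REF2 v28).  BSD is not proved by any of this.
[cite: KramerTunnell1982, Thm. 7.6, Lemma 7.5, Lemma 8.23, Prop. 8.24] [cite: DokchitserDokchitser2011Crelle, Thm. 5 (arXiv numbering; = Thm. 24)]
[cite: CesnaviciusImai2015] [cite: BarriosEtAl2025, Thm. 5.1] [cite: Kraus1989] [cite: Papadopoulos1993] [cite: DoyonLei2021, §5] -/
@[conjecture] def LocalTowerSignLawAtTwo : Prop :=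
  ∀ (W : WeierstrassCurve ℚ) [W.IsElliptic], 4 ∣ W.conductorNorm ℤ →
    ∀ (κ : ZpExtension ℚ 2), κ.IsCyclotomic →
    ∀ n : ℕ, 2 ≤ n → conductorExponentAtTwo W ≤ 2 * n + 2 →
      LayerAdditiveAboveTwo W κ (n - 1) → LayerAdditiveAboveTwo W κ n →
      (Even (towerCorrectionJumpAtTwo W κ n + newPartPhaseIndicator W n) ↔ twoAdicTwistSign W = 1)

/-- **IMC-FEP `NewPartPhaseLawAtTwo`** — support, print-assembly grade (functional equation of `L(f ⊗ χ, s)` for `χ` of conductor `2^{n+2}`,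
`n ≥ 2`, `f₂ ≤ 2n+2`: `Λ(f⊗χ, s) = ρ·Λ(f⊗χ̄, 2−s)` with `ρ = w(W)·χ(N′)·τ(χ)²/2^{n+2}·(phase at 2)`, and `v_π` of the new-part norm on the
totally real `ℚ(ζ_{2^n})⁺`-side is even unless the phase class is non-trivial; Atkin–Li pseudo-eigenvalue at additive 2, DEW 2021 Thm 38
pattern — REF2 v26 §1.8 r6).  For the newform `f` of `W`, `4 ∣ N_W`, `n ≥ 2`, `f₂ ≤ 2n+2`, `θ_n(f) ≠ 0`:
`ℓ′_n(θ_n) + X_n ≡ 0 (mod 2) ⟺ χ₈(N′) = +1`.  PIN-FREE: rescaling `θ_n` by `c ∈ ℚˣ` shifts `ℓ′_n` by `2^{n−1}v₂(c)`, even for `n ≥ 2`.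
Census (θ-side of D-imc-22/23, `xn_test.py`): `n = 2`: 3 790/3 790 (`f₂ ≤ 6`; the 39 curves with `f₂ ∈ {7,8}` split by type and are outside
the typed range), `n = 3`: 4 297/4 297, `n = 4`: 4 431/4 431, `n = 5`: 4 461/4 461 — 0 violations on 16 979 cells.
[cite: DokchitserEvansWiersema2020, Thm. 38] [cite: AtkinLi1978, Thm. 4.1] -/
def NewPartPhaseLawAtTwo : Prop :=
  ∀ {N : ℕ} [NeZero N] (f : CuspForm (Gamma0 N) 2) (W : WeierstrassCurve ℚ) [W.IsElliptic],
    IsNewformOf W f → 4 ∣ W.conductorNorm ℤ →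
    ∀ n : ℕ, 2 ≤ n → conductorExponentAtTwo W ≤ 2 * n + 2 → mazurTateElement f 2 n ≠ 0 →
      (Even (newPartNormTwoVal n (mazurTateElement f 2 n) + newPartPhaseIndicator W n) ↔
        ZMod.χ₈ (oddConductorPart W : ZMod 8) = 1)

/-- **IMC-SIGN≥2 `AdditiveNewPartSignLawAtTwoFrom2`** — the restriction of the SIGN law of record (`AdditiveNewPartSignLawAtTwo`, p628841)
to `n ≥ 2`, `f₂ ≤ 2n + 2`, with the census-scope hypotheses (`IsGloballyMinimal`, `¬HasCM`, `NoRationalTwoTorsion`, period pin) that its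
BSD derivation does not use REMOVED (REF1 §95 noted they are not used): for the newform `f` of `W`, `4 ∣ N_W`, `κ` cyclotomic, `n ≥ 2`,
`f₂ ≤ 2n+2`, additive above `2` at layers `n − 1`, `n`, `θ_n ≠ 0`, and ANY `ϖ ≠ 0`:
`Even (R_n) ⟺ w(W)·w(W^{(2)}) = +1`.  It is the target of the glue below. -/
def AdditiveNewPartSignLawAtTwoFrom2 : Prop :=
  ∀ {N : ℕ} [NeZero N] (f : CuspForm (Gamma0 N) 2) (W : WeierstrassCurve ℚ) [W.IsElliptic] (ϖ : ℚ), ϖ ≠ 0 →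
    IsNewformOf W f → 4 ∣ W.conductorNorm ℤ →
    ∀ (κ : ZpExtension ℚ 2), κ.IsCyclotomic →
    ∀ n : ℕ, 2 ≤ n → conductorExponentAtTwo W ≤ 2 * n + 2 →
      LayerAdditiveAboveTwo W κ (n - 1) → LayerAdditiveAboveTwo W κ n →
      mazurTateElement f 2 n ≠ 0 →
      (Even (additiveNewPartIndex f W ϖ κ n) ↔ W.rootNumber * (W.quadraticTwist 2).rootNumber = 1)

/-- **The glue (support, kernel target): LTS + FEP ⇒ SIGN on `n ≥ 2`, `f₂ ≤ 2n+2`.**  Parity arithmetic: `R_n = ℓ′_n − J_n`,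
`Even(ℓ′_n + X_n) ↔ χ₈(N′) = 1`, `Even(J_n + X_n) ↔ w·w₈·χ₈(N′) = 1`, all signs in `{±1}`, and `ℓ′_n(C ϖ·θ_n) ≡ ℓ′_n(θ_n) (mod 2)` for
`n ≥ 2` (norm of degree `2^{n−1}`).  Stated as a `Prop` (the resultant rescaling lemma `newPartNormTwoVal n (C c * P) = newPartNormTwoVal n P
+ 2^{n−1}·v₂ c` for `P ≠ 0` is prover work). -/
def SignLawSplitsAtTwo : Prop :=
  LocalTowerSignLawAtTwo → NewPartPhaseLawAtTwo → AdditiveNewPartSignLawAtTwoFrom2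

/-- **IMC-LTS-pm (support; FIRST RUNG T2 of MEMO-imc §10.70 (c)): the tower sign law restricted to POTENTIALLY MULTIPLICATIVE
reduction at 2** (`v₂(j) < 0`; then `f₂ ∈ {4, 6}` and `E ≃ E_q ⊗ χ` with `χ ∈ {χ₋₄, χ₋₈}` over every layer `n ≥ 1`).  Census D-imc-30:
1 724 X5 cells (431 curves) + 2 728 random-model cells (682 models), 0 violations; the Tate data is an explicit function of
`(n, f₂, v₂(q))` for `n ≥ 2` (Kodaira `I*_{2^n·v₂(q)+4}`, `c = 4`, `δTam = 0`, `δu_n` even except `δu_2 = 3` at `f₂ = 6` where the phase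
`X_2 = 1` compensates), and `ρ₂ = χ₋₄(−1)·χ₋₈(−1) = +1` by Rohrlich's formula — a finite hand computation, nominated first prover target.
REF1 §106 r3 (pot.-mult. family classified by `γ = −c₄/c₆`): `W ≃ E_q ⊗ χ_d`, `d ∈ {−1, −2, 3, 6}·ℚ₂^{×2}` = `χ₋₄`/`χ₋₈`-twists of the split (213 X5
curves) or non-split (218 X5) Tate curve; `d ∈ {2, −6}` (50 curves, `f₂ = 6`) go multiplicative over `ℚ_1` and are outside the hypotheses; closed
form `I*_{2^k v(q)+4}`, `f = 4`, `c_k = 4` for `k ≥ 1` in BOTH classes (431 × 5), `δTam = 0`, `δu_n ∈ {2^{n−1}, 3·2^{n−2}}`,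
`ρ₂ = χ_d(−1)·χ_{2d}(−1) = +1`.  REF2 v28 r4: for the proof cite KT82 §§5–6 + Thm 7.6 (norm index of twisted Tate curves) instead of re-deriving;
the explicit table is then a check, not the proof.  REF1 §106: SURVIVES (support).  [cite: KramerTunnell1982, §5, §6, Thm. 7.6] -/
def LocalTowerSignLawAtTwoPotMult : Prop :=
  ∀ (W : WeierstrassCurve ℚ) [W.IsElliptic], 4 ∣ W.conductorNorm ℤ → padicValRat 2 W.j < 0 →
    ∀ (κ : ZpExtension ℚ 2), κ.IsCyclotomic →
    ∀ n : ℕ, 2 ≤ n → conductorExponentAtTwo W ≤ 2 * n + 2 →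
      LayerAdditiveAboveTwo W κ (n - 1) → LayerAdditiveAboveTwo W κ n →
      (Even (towerCorrectionJumpAtTwo W κ n + newPartPhaseIndicator W n) ↔ twoAdicTwistSign W = 1)

/-- IMC-LTS ⇒ IMC-LTS-pm (restriction to `v₂(j) < 0`; pure logic). -/
theorem localTowerSignLawAtTwoPotMult_of_localTowerSignLawAtTwo (h : LocalTowerSignLawAtTwo) :
    LocalTowerSignLawAtTwoPotMult :=
  fun W _ h4 _ κ hκ n hn hf ha hb => h W h4 κ hκ n hn hf ha hb

/-! ### Sanity: the helper defs compute on closed terms -/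

example : newPartPhaseIndicator (⟨0, 0, 0, 0, 0⟩ : WeierstrassCurve ℚ) 0
    = (if conductorExponentAtTwo (⟨0, 0, 0, 0, 0⟩ : WeierstrassCurve ℚ) = 2 then 1 else 0) := by
  simp [newPartPhaseIndicator]

end Summit.BirchSwinnertonDyer.Rank1Residual.F1Sign2

end
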